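import Literature.NumberTheory.DiophantineGeometry.KroneckerSemigroup
import Mathlib.LinearAlgebra.Matrix.MvPolynomial
import HarnessLib

/-!
# Kronecker coefficients as spaces of semi-invariant polynomials on triples of matrices:
# the dictionary between symmetric triple tensors and polynomials, and division by a determinant

Infrastructure for the stability of rectangular Kronecker coefficients
(`KroneckerRectangularStability.lean`; L. Manivel, J. Algebr. Comb. 33 (2011) Thm. 1 /
C. Ikenmeyer–G. Panova, Adv. Math. 319 (2017) Thm. 2.1), in the word model of the tree
(`TensorWordModel`, `KroneckerSemigroup`): by `finrank_invariants_tripleHwRep`,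
`g(λ, μ, ν) = dim (HW_λ ⊗ HW_μ ⊗ HW_ν)^{S_n}`, the `S_n`-invariant functions `M` on triples of words
all of whose partial functions are highest-weight vectors of `(k^N)^{⊗n}`.

* §1 The polynomial `P_M = ∑_t M(t) X^{t} ∈ k[X_x : x ∈ (Fin N × Fin N) × Fin N]` of a triple
  tensor (`triplePoly`, the tree's `wordPoly` on zipped words) and the symmetric array of a form
  (`tripleArr`, the tree's `arrOf`): mutually inverse between symmetric triple tensors of length
  `n` and forms of degree `n` (characteristic zero).
* §2 The three "leg" actions of `GL_N` on triple tensors (`legAct₁/₂/₃`, `wordRep` in one of the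
  three words) correspond under `P` to linear substitutions of the variables in one of the three
  indices (`legSubst₁/₂/₃`): `P_{g ·ᵢ M} = gᵢ · P_M` (`triplePoly_legActᵢ`).
* §3 The space `symTripleHw χ₁ χ₂ χ₃` of symmetric triple tensors with highest-weight partial
  functions has dimension `g(λ, μ, ν)` (`finrank_symTripleHw`); membership is leg-wise
  semi-invariance (`mem_symTripleHw_iff_legAct`).
* §4 The determinant `D = det (X_{((0, i), j)})_{i, j < d}` of the `d × d` matrix of variables
  attached to the letter `0` of the first word (`legDet`): nonzero, homogeneous of degree `d`, and a
  semi-invariant of weight `(d ε₀, 1^d, 1^d)` for the three Borel subgroups (`legSubstᵢ_legDet`).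
* §5 Division by `D`: if every `P_M`, `M ∈ symTripleHw (n := a + d) χ`, is divisible by `D`, then
  `M ↦ (array of P_M / D)` is an injective linear map into `symTripleHw (n := a) (χ - (dε₀,1^d,1^d))`
  (`finrank_symTripleHw_le_of_forall_dvd`): the quotient inherits homogeneity and the three
  semi-invariances by cancellation in the domain `k[X]`.

All statements are over a field of characteristic zero (the dictionary divides by multinomial
coefficients, and weight vectors are detected by contents).

## References

* L. Manivel, *On rectangular Kronecker coefficients*, J. Algebraic Combin. 33 (2011) 153–162,
  §2 and §3.4 (the algebra `A = ⊕ Sym(E ⊗ F ⊗ G)^{SL(E)×SL(F)×U_G}`, `dim A_λ = k_{(d^n),(d^n),λ}`).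
  [key `Manivel2011`]
* C. Ikenmeyer, G. Panova, Adv. Math. 319 (2017) 40–66, §1.1 ("`g(λ, μ, ν)` as the dimension of
  the `(λ, μ, ν)`-highest weight vector space in the coordinate ring of `V ⊗ V ⊗ V`").
  [key `IkenmeyerPanova2017`]
* W. Fulton, J. Harris, *Representation Theory*, GTM 129, §6.1, §15.3. [key `FultonHarrisGTM129`]
-/

noncomputable section

open scoped BigOperators

namespace Literature.NumberTheory.DiophantineGeometry

open MvPolynomial Literature.Computability.AlgebraicComplexity

/-! ### §1 Triple tensors as polynomials and back -/

section Dictionary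

variable {k : Type*} [Field k] {N n : ℕ}

/-- The alphabet of the polynomial model: triples of letters `((l, i), j)` (first, second, third
word). [folklore] -/
abbrev Alpha (N : ℕ) : Type := (Fin N × Fin N) × Fin N

/-- Zipping commutes with the position action (restated from `zip3_symm_comp`). [folklore] -/
theorem zip3_permute3 (τ : Equiv.Perm (Fin n)) (t : Word3 N n) :
    zip3 (permute3 τ t) = zip3 t ∘ ⇑τ :=
  rfl

/-- **The polynomial of a triple tensor**: `P_M = ∑_t M(t) · ∏_p X_{(t)_p}` in the variables
`X_x`, `x ∈ (Fin N × Fin N) × Fin N` (the tree's `wordPoly` of the zipped function; the image of the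
tensor in `Sym^n (E ⊗ F ⊗ G)`). [cite: Manivel2011, §3.4 (the algebra A)] -/
def triplePoly (M : Word3 N n → k) : MvPolynomial (Alpha N) k :=
  wordPoly (M ∘ ⇑(zip3 (N := N) (n := n)).symm)

/-- `P_M = ∑_t C(M t) · ∏_p X_{zip t p}`. [folklore] -/
theorem triplePoly_eq_sum (M : Word3 N n → k) :
    triplePoly M = ∑ t : Word3 N n, C (M t) * ∏ p, X (zip3 t p) := by
  rw [triplePoly, wordPoly]
  refine Fintype.sum_equiv (zip3 (N := N) (n := n)).symm _ _ fun w => ?_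
  rw [Function.comp_apply, prod_X_eq_monomial_wordExp, smul_eq_C_mul, Equiv.apply_symm_apply]

/-- `P_M` is additive. [folklore] -/
theorem triplePoly_add (M M' : Word3 N n → k) :
    triplePoly (M + M') = triplePoly M + triplePoly M' := by
  simp only [triplePoly_eq_sum, Pi.add_apply, map_add, add_mul, Finset.sum_add_distrib]

/-- `P_M` is homogeneous in scalars. [folklore] -/
theorem triplePoly_smul (c : k) (M : Word3 N n → k) :
    triplePoly (c • M) = c • triplePoly M := by
  simp only [triplePoly_eq_sum, Pi.smul_apply, smul_eq_mul, map_mul, Finset.smul_sum,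
    smul_eq_C_mul, mul_assoc]

/-- `P_0 = 0`. [folklore] -/
theorem triplePoly_zero : triplePoly (0 : Word3 N n → k) = 0 := by
  simp [triplePoly_eq_sum]

/-- `P_M` is a form of degree `n` (every monomial is a product of `n` variables). [folklore] -/
theorem isHomogeneous_triplePoly (M : Word3 N n → k) : (triplePoly M).IsHomogeneous n := by
  rw [triplePoly_eq_sum]
  refine IsHomogeneous.sum _ _ _ fun t _ => ?_
  have h : (∏ p : Fin n, (X (zip3 t p) : MvPolynomial (Alpha N) k)).IsHomogeneous n := by
    have := IsHomogeneous.prod (Finset.univ : Finset (Fin n))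
      (fun p => (X (zip3 t p) : MvPolynomial (Alpha N) k)) (fun _ => 1)
      (fun p _ => isHomogeneous_X _ _)
    simpa using this
  exact h.C_mul _

/-- **`P` is injective on symmetric triple tensors** (characteristic zero): the coefficient of a
monomial is the number of words of that content times the common value of `M` on them.
[folklore] -/
theorem eq_zero_of_triplePoly_eq_zero [CharZero k] {M : Word3 N n → k}
    (hM : ∀ τ t, M (permute3 τ t) = M t) (h0 : triplePoly M = 0) : M = 0 := by
  classical
  have h := eq_zero_of_wordPoly_eq_zero (F := M ∘ ⇑(zip3 (N := N) (n := n)).symm)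
    (fun τ w => by
      change M (zip3.symm (w ∘ ⇑τ)) = M (zip3.symm w)
      rw [zip3_symm_comp, hM]) h0
  funext t
  have := congrFun h (zip3 t)
  simpa using this

/-- **The symmetric triple tensor of a form** of degree `n`: the tree's symmetric array `arrOf`
read on triples of words, `A(q)(t) = coeff_{X^{zip t}}(q) / #{words of that content}`.
[folklore] -/
def tripleArr (n : ℕ) (q : MvPolynomial (Alpha N) k) : Word3 N n → k :=
  fun t => arrOf n q (zip3 t)

/-- The array of a form is symmetric under the position action. [folklore] -/
theorem tripleArr_permute3 (q : MvPolynomial (Alpha N) k) (τ : Equiv.Perm (Fin n))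
    (t : Word3 N n) : tripleArr n q (permute3 τ t) = tripleArr n q t := by
  rw [tripleArr, tripleArr, zip3_permute3, arrOf_comp_perm]

/-- The array is additive in the form. [folklore] -/
theorem tripleArr_add (q q' : MvPolynomial (Alpha N) k) :
    tripleArr n (q + q') = tripleArr n q + tripleArr n q' := by
  funext t
  simp only [tripleArr, Pi.add_apply, arrOf, coeff_add, add_div]

/-- The array is homogeneous in the form. [folklore] -/
theorem tripleArr_smul (c : k) (q : MvPolynomial (Alpha N) k) :
    tripleArr n (c • q) = c • tripleArr n q := by
  funext t
  simp only [tripleArr, Pi.smul_apply, arrOf, coeff_smul, smul_eq_mul, mul_div_assoc]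

/-- The array of `0` is `0`. [folklore] -/
theorem tripleArr_zero : tripleArr n (0 : MvPolynomial (Alpha N) k) = 0 := by
  funext t
  simp [tripleArr, arrOf]

/-- **`P ∘ A = id` on forms of degree `n`** (symmetrisation of the array, characteristic zero).
[folklore] -/
theorem triplePoly_tripleArr [CharZero k] {q : MvPolynomial (Alpha N) k} (hq : q.IsHomogeneous n) :
    triplePoly (tripleArr n q) = q := by
  rw [triplePoly_eq_sum]
  conv_rhs => rw [← sum_arrOf_mul_prod_X hq]
  exact Fintype.sum_equiv (zip3 (N := N) (n := n)) _ _ fun t => rfl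

/-- **`A ∘ P = id` on symmetric triple tensors** (characteristic zero). [folklore] -/
theorem tripleArr_triplePoly [CharZero k] {M : Word3 N n → k}
    (hM : ∀ τ t, M (permute3 τ t) = M t) : tripleArr n (triplePoly M) = M := by
  classical
  funext t
  rw [tripleArr, triplePoly_eq_sum]
  have hsym : ∀ (I : Fin n → Alpha N) (π : Equiv.Perm (Fin n)),
      (M ∘ ⇑(zip3 (N := N) (n := n)).symm) (I ∘ ⇑π) = (M ∘ ⇑(zip3 (N := N) (n := n)).symm) I := by
    intro I π
    change M (zip3.symm (I ∘ ⇑π)) = M (zip3.symm I)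
    rw [zip3_symm_comp, hM]
  have h := arrOf_sum_C_mul_prod_X (k := k) (ℓ := n) hsym (zip3 t)
  have hre : (∑ I : Fin n → Alpha N, C ((M ∘ ⇑(zip3 (N := N) (n := n)).symm) I) * ∏ j, X (I j)) =
      ∑ t' : Word3 N n, C (M t') * ∏ p, X (zip3 t' p) :=
    Fintype.sum_equiv (zip3 (N := N) (n := n)).symm _ _ fun I => by
      simp only [Function.comp_apply]
      rfl
  rw [hre] at h
  rw [h]
  simp

end Dictionary

/-! ### §2 The three leg actions and the corresponding substitutions -/

section Legs

variable {k : Type*} [Field k] {N n : ℕ}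

/-- The action of `g ∈ GL_N` on the FIRST word of a triple tensor (`wordRep` on the partial
functions `u ↦ M((u, v), w)`). [folklore] -/
def legAct₁ (g : GL (Fin N) k) (M : Word3 N n → k) : Word3 N n → k :=
  fun t => wordRep k N n g (fun u => M ((u, t.1.2), t.2)) t.1.1

/-- The action of `g ∈ GL_N` on the SECOND word of a triple tensor. [folklore] -/
def legAct₂ (g : GL (Fin N) k) (M : Word3 N n → k) : Word3 N n → k :=
  fun t => wordRep k N n g (fun v => M ((t.1.1, v), t.2)) t.1.2

/-- The action of `g ∈ GL_N` on the THIRD word of a triple tensor. [folklore] -/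
def legAct₃ (g : GL (Fin N) k) (M : Word3 N n → k) : Word3 N n → k :=
  fun t => wordRep k N n g (fun w => M (t.1, w)) t.2

/-- Formula: `(g ·₁ M)((u', v), w) = ∑_u (∏_p g_{u' p, u p}) M((u, v), w)`. [folklore] -/
theorem legAct₁_apply (g : GL (Fin N) k) (M : Word3 N n → k) (t : Word3 N n) :
    legAct₁ g M t = ∑ u : Word N n, (∏ p, (g : Matrix (Fin N) (Fin N) k) (t.1.1 p) (u p)) *
      M ((u, t.1.2), t.2) :=
  rfl

/-- Formula for the second leg. [folklore] -/
theorem legAct₂_apply (g : GL (Fin N) k) (M : Word3 N n → k) (t : Word3 N n) :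
    legAct₂ g M t = ∑ v : Word N n, (∏ p, (g : Matrix (Fin N) (Fin N) k) (t.1.2 p) (v p)) *
      M ((t.1.1, v), t.2) :=
  rfl

/-- Formula for the third leg. [folklore] -/
theorem legAct₃_apply (g : GL (Fin N) k) (M : Word3 N n → k) (t : Word3 N n) :
    legAct₃ g M t = ∑ w : Word N n, (∏ p, (g : Matrix (Fin N) (Fin N) k) (t.2 p) (w p)) *
      M (t.1, w) :=
  rfl

/-- The leg actions are additive. [folklore] -/
theorem legAct₁_add (g : GL (Fin N) k) (M M' : Word3 N n → k) :
    legAct₁ g (M + M') = legAct₁ g M + legAct₁ g M' := by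
  funext t; simp only [legAct₁_apply, Pi.add_apply, mul_add, Finset.sum_add_distrib]

/-- The leg actions are additive. [folklore] -/
theorem legAct₂_add (g : GL (Fin N) k) (M M' : Word3 N n → k) :
    legAct₂ g (M + M') = legAct₂ g M + legAct₂ g M' := by
  funext t; simp only [legAct₂_apply, Pi.add_apply, mul_add, Finset.sum_add_distrib]

/-- The leg actions are additive. [folklore] -/
theorem legAct₃_add (g : GL (Fin N) k) (M M' : Word3 N n → k) :
    legAct₃ g (M + M') = legAct₃ g M + legAct₃ g M' := by
  funext t; simp only [legAct₃_apply, Pi.add_apply, mul_add, Finset.sum_add_distrib]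

/-- The leg actions commute with scalars. [folklore] -/
theorem legAct₁_smul (g : GL (Fin N) k) (c : k) (M : Word3 N n → k) :
    legAct₁ g (c • M) = c • legAct₁ g M := by
  funext t
  simp only [legAct₁_apply, Pi.smul_apply, smul_eq_mul, Finset.mul_sum]
  exact Finset.sum_congr rfl fun _ _ => by ring

/-- The leg actions commute with scalars. [folklore] -/
theorem legAct₂_smul (g : GL (Fin N) k) (c : k) (M : Word3 N n → k) :
    legAct₂ g (c • M) = c • legAct₂ g M := by
  funext t
  simp only [legAct₂_apply, Pi.smul_apply, smul_eq_mul, Finset.mul_sum]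
  exact Finset.sum_congr rfl fun _ _ => by ring

/-- The leg actions commute with scalars. [folklore] -/
theorem legAct₃_smul (g : GL (Fin N) k) (c : k) (M : Word3 N n → k) :
    legAct₃ g (c • M) = c • legAct₃ g M := by
  funext t
  simp only [legAct₃_apply, Pi.smul_apply, smul_eq_mul, Finset.mul_sum]
  exact Finset.sum_congr rfl fun _ _ => by ring

/-- The leg actions preserve symmetry under the diagonal position action. [folklore] -/
theorem legAct₁_permute3 (g : GL (Fin N) k) {M : Word3 N n → k}
    (hM : ∀ τ t, M (permute3 τ t) = M t) (τ : Equiv.Perm (Fin n)) (t : Word3 N n) :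
    legAct₁ g M (permute3 τ t) = legAct₁ g M t := by
  simp only [legAct₁_apply]
  -- reindex `u ↦ u ∘ τ`
  let e : Word N n ≃ Word N n := Equiv.arrowCongr τ (Equiv.refl (Fin N))
  refine (Fintype.sum_equiv e.symm _ _ fun u => ?_).symm
  have hu : e.symm u = u ∘ ⇑τ := by
    funext p; simp [e, Equiv.arrowCongr_symm, Equiv.arrowCongr_apply]
  rw [hu]
  have h1 : M ((u ∘ ⇑τ, (permute3 τ t).1.2), (permute3 τ t).2) = M ((u, t.1.2), t.2) :=
    hM τ ((u, t.1.2), t.2)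
  rw [h1]
  congr 1
  exact (Equiv.prod_comp τ (fun q => (g : Matrix (Fin N) (Fin N) k) (t.1.1 q) (u q))).symm

/-- The leg actions preserve symmetry under the diagonal position action. [folklore] -/
theorem legAct₂_permute3 (g : GL (Fin N) k) {M : Word3 N n → k}
    (hM : ∀ τ t, M (permute3 τ t) = M t) (τ : Equiv.Perm (Fin n)) (t : Word3 N n) :
    legAct₂ g M (permute3 τ t) = legAct₂ g M t := by
  simp only [legAct₂_apply]
  let e : Word N n ≃ Word N n := Equiv.arrowCongr τ (Equiv.refl (Fin N))
  refine (Fintype.sum_equiv e.symm _ _ fun v => ?_).symm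
  have hv : e.symm v = v ∘ ⇑τ := by
    funext p; simp [e, Equiv.arrowCongr_symm, Equiv.arrowCongr_apply]
  rw [hv]
  have h1 : M (((permute3 τ t).1.1, v ∘ ⇑τ), (permute3 τ t).2) = M ((t.1.1, v), t.2) :=
    hM τ ((t.1.1, v), t.2)
  rw [h1]
  congr 1
  exact (Equiv.prod_comp τ (fun q => (g : Matrix (Fin N) (Fin N) k) (t.1.2 q) (v q))).symm

/-- The leg actions preserve symmetry under the diagonal position action. [folklore] -/
theorem legAct₃_permute3 (g : GL (Fin N) k) {M : Word3 N n → k}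
    (hM : ∀ τ t, M (permute3 τ t) = M t) (τ : Equiv.Perm (Fin n)) (t : Word3 N n) :
    legAct₃ g M (permute3 τ t) = legAct₃ g M t := by
  simp only [legAct₃_apply]
  let e : Word N n ≃ Word N n := Equiv.arrowCongr τ (Equiv.refl (Fin N))
  refine (Fintype.sum_equiv e.symm _ _ fun w => ?_).symm
  have hw : e.symm w = w ∘ ⇑τ := by
    funext p; simp [e, Equiv.arrowCongr_symm, Equiv.arrowCongr_apply]
  rw [hw]
  have h1 : M ((permute3 τ t).1, w ∘ ⇑τ) = M (t.1, w) := hM τ (t.1, w)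
  rw [h1]
  congr 1
  exact (Equiv.prod_comp τ (fun q => (g : Matrix (Fin N) (Fin N) k) (t.2 q) (w q))).symm

variable (N) in
/-- Linear substitution in the FIRST index of the variables: `X_{((l,i),j)} ↦ ∑_{l'} g_{l' l} X_{((l',i),j)}`
(the action of `g ∈ GL(G)` on `Sym(E ⊗ F ⊗ G)`, column convention as `linSubst`). [folklore] -/
def legSubst₁ (g : Matrix (Fin N) (Fin N) k) : MvPolynomial (Alpha N) k →ₐ[k] MvPolynomial (Alpha N) k :=
  aeval fun x => ∑ l : Fin N, g l x.1.1 • X ((l, x.1.2), x.2)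

variable (N) in
/-- Linear substitution in the SECOND index of the variables. [folklore] -/
def legSubst₂ (g : Matrix (Fin N) (Fin N) k) : MvPolynomial (Alpha N) k →ₐ[k] MvPolynomial (Alpha N) k :=
  aeval fun x => ∑ i : Fin N, g i x.1.2 • X ((x.1.1, i), x.2)

variable (N) in
/-- Linear substitution in the THIRD index of the variables. [folklore] -/
def legSubst₃ (g : Matrix (Fin N) (Fin N) k) : MvPolynomial (Alpha N) k →ₐ[k] MvPolynomial (Alpha N) k :=
  aeval fun x => ∑ j : Fin N, g j x.2 • X (x.1, j)

/-- `legSubst₁` on a variable. [folklore] -/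
@[simp] theorem legSubst₁_X (g : Matrix (Fin N) (Fin N) k) (x : Alpha N) :
    legSubst₁ N g (X x) = ∑ l : Fin N, g l x.1.1 • X ((l, x.1.2), x.2) := by
  simp [legSubst₁]

/-- `legSubst₂` on a variable. [folklore] -/
@[simp] theorem legSubst₂_X (g : Matrix (Fin N) (Fin N) k) (x : Alpha N) :
    legSubst₂ N g (X x) = ∑ i : Fin N, g i x.1.2 • X ((x.1.1, i), x.2) := by
  simp [legSubst₂]

/-- `legSubst₃` on a variable. [folklore] -/
@[simp] theorem legSubst₃_X (g : Matrix (Fin N) (Fin N) k) (x : Alpha N) :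
    legSubst₃ N g (X x) = ∑ j : Fin N, g j x.2 • X (x.1, j) := by
  simp [legSubst₃]

/-- A product of sums over the positions, expanded: `∏_p ∑_l a(l, p) • X(b(l, p)) =
∑_{u : Word} (∏_p a(u p, p)) • ∏_p X(b(u p, p))`. [folklore] -/
theorem prod_sum_smul_X (a : Fin N → Fin n → k) (b : Fin N → Fin n → Alpha N) :
    (∏ p : Fin n, ∑ l : Fin N, a l p • (X (b l p) : MvPolynomial (Alpha N) k)) =
      ∑ u : Word N n, (∏ p, a (u p) p) • ∏ p, (X (b (u p) p) : MvPolynomial (Alpha N) k) := by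
  rw [Finset.prod_univ_sum]
  refine Finset.sum_congr rfl fun u _ => ?_
  simp only [smul_eq_C_mul, Finset.prod_mul_distrib, map_prod]

/-- The reindexing equivalence exchanging the first word of a triple with a fourth word.
[folklore] -/
def swapFirst : Word3 N n × Word N n ≃ Word3 N n × Word N n where
  toFun x := (((x.2, x.1.1.2), x.1.2), x.1.1.1)
  invFun x := (((x.2, x.1.1.2), x.1.2), x.1.1.1)
  left_inv _ := rfl
  right_inv _ := rfl

/-- The reindexing equivalence exchanging the second word of a triple with a fourth word.
[folklore] -/
def swapSecond : Word3 N n × Word N n ≃ Word3 N n × Word N n where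
  toFun x := (((x.1.1.1, x.2), x.1.2), x.1.1.2)
  invFun x := (((x.1.1.1, x.2), x.1.2), x.1.1.2)
  left_inv _ := rfl
  right_inv _ := rfl

/-- The reindexing equivalence exchanging the third word of a triple with a fourth word.
[folklore] -/
def swapThird : Word3 N n × Word N n ≃ Word3 N n × Word N n where
  toFun x := ((x.1.1, x.2), x.1.2)
  invFun x := ((x.1.1, x.2), x.1.2)
  left_inv _ := rfl
  right_inv _ := rfl

/-- **The dictionary intertwines leg action and substitution, first leg**:
`P_{g ·₁ M} = g ·₁ P_M`. [folklore] -/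
theorem triplePoly_legAct₁ (g : GL (Fin N) k) (M : Word3 N n → k) :
    triplePoly (legAct₁ g M) = legSubst₁ N (g : Matrix (Fin N) (Fin N) k) (triplePoly M) := by
  set G : Matrix (Fin N) (Fin N) k := (g : Matrix (Fin N) (Fin N) k) with hG
  -- the common summand
  let F : Word3 N n → Word N n → MvPolynomial (Alpha N) k := fun t u =>
    C ((∏ p, G (t.1.1 p) (u p)) * M ((u, t.1.2), t.2)) * ∏ p, X (zip3 t p)
  have hL : triplePoly (legAct₁ g M) = ∑ t : Word3 N n, ∑ u : Word N n, F t u := by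
    simp only [triplePoly_eq_sum, legAct₁_apply, map_sum, Finset.sum_mul, F, hG]
  have hR : legSubst₁ N G (triplePoly M) =
      ∑ t : Word3 N n, ∑ u' : Word N n, F ((u', t.1.2), t.2) t.1.1 := by
    rw [triplePoly_eq_sum, map_sum]
    refine Finset.sum_congr rfl fun t _ => ?_
    rw [map_mul, MvPolynomial.algHom_C, MvPolynomial.algebraMap_eq, map_prod]
    simp only [legSubst₁_X]
    rw [prod_sum_smul_X (fun l p => G l (zip3 t p).1.1) (fun l p => ((l, (zip3 t p).1.2), (zip3 t p).2)),
      Finset.mul_sum]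
    refine Finset.sum_congr rfl fun u' _ => ?_
    simp only [F, smul_eq_C_mul]
    rw [← mul_assoc, ← map_mul, mul_comm (M t)]
    rfl
  rw [hL, hR, ← Fintype.sum_prod_type', ← Fintype.sum_prod_type']
  exact Fintype.sum_equiv swapFirst _ _ fun x => rfl

/-- **The dictionary intertwines leg action and substitution, second leg.** [folklore] -/
theorem triplePoly_legAct₂ (g : GL (Fin N) k) (M : Word3 N n → k) :
    triplePoly (legAct₂ g M) = legSubst₂ N (g : Matrix (Fin N) (Fin N) k) (triplePoly M) := by
  set G : Matrix (Fin N) (Fin N) k := (g : Matrix (Fin N) (Fin N) k) with hG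
  let F : Word3 N n → Word N n → MvPolynomial (Alpha N) k := fun t v =>
    C ((∏ p, G (t.1.2 p) (v p)) * M ((t.1.1, v), t.2)) * ∏ p, X (zip3 t p)
  have hL : triplePoly (legAct₂ g M) = ∑ t : Word3 N n, ∑ v : Word N n, F t v := by
    simp only [triplePoly_eq_sum, legAct₂_apply, map_sum, Finset.sum_mul, F, hG]
  have hR : legSubst₂ N G (triplePoly M) =
      ∑ t : Word3 N n, ∑ v' : Word N n, F ((t.1.1, v'), t.2) t.1.2 := by
    rw [triplePoly_eq_sum, map_sum]
    refine Finset.sum_congr rfl fun t _ => ?_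
    rw [map_mul, MvPolynomial.algHom_C, MvPolynomial.algebraMap_eq, map_prod]
    simp only [legSubst₂_X]
    rw [prod_sum_smul_X (fun i p => G i (zip3 t p).1.2) (fun i p => (((zip3 t p).1.1, i), (zip3 t p).2)),
      Finset.mul_sum]
    refine Finset.sum_congr rfl fun v' _ => ?_
    simp only [F, smul_eq_C_mul]
    rw [← mul_assoc, ← map_mul, mul_comm (M t)]
    rfl
  rw [hL, hR, ← Fintype.sum_prod_type', ← Fintype.sum_prod_type']
  exact Fintype.sum_equiv swapSecond _ _ fun x => rfl

/-- **The dictionary intertwines leg action and substitution, third leg.** [folklore] -/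
theorem triplePoly_legAct₃ (g : GL (Fin N) k) (M : Word3 N n → k) :
    triplePoly (legAct₃ g M) = legSubst₃ N (g : Matrix (Fin N) (Fin N) k) (triplePoly M) := by
  set G : Matrix (Fin N) (Fin N) k := (g : Matrix (Fin N) (Fin N) k) with hG
  let F : Word3 N n → Word N n → MvPolynomial (Alpha N) k := fun t w =>
    C ((∏ p, G (t.2 p) (w p)) * M (t.1, w)) * ∏ p, X (zip3 t p)
  have hL : triplePoly (legAct₃ g M) = ∑ t : Word3 N n, ∑ w : Word N n, F t w := by
    simp only [triplePoly_eq_sum, legAct₃_apply, map_sum, Finset.sum_mul, F, hG]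
  have hR : legSubst₃ N G (triplePoly M) =
      ∑ t : Word3 N n, ∑ w' : Word N n, F (t.1, w') t.2 := by
    rw [triplePoly_eq_sum, map_sum]
    refine Finset.sum_congr rfl fun t _ => ?_
    rw [map_mul, MvPolynomial.algHom_C, MvPolynomial.algebraMap_eq, map_prod]
    simp only [legSubst₃_X]
    rw [prod_sum_smul_X (fun j p => G j (zip3 t p).2) (fun j p => ((zip3 t p).1, j)),
      Finset.mul_sum]
    refine Finset.sum_congr rfl fun w' _ => ?_
    simp only [F, smul_eq_C_mul]
    rw [← mul_assoc, ← map_mul, mul_comm (M t)]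
    rfl
  rw [hL, hR, ← Fintype.sum_prod_type', ← Fintype.sum_prod_type']
  exact Fintype.sum_equiv swapThird _ _ fun x => rfl

end Legs

/-! ### §3 Symmetric triple tensors with highest-weight partial functions -/

section Spaces

variable {k : Type*} [Field k] {N n : ℕ}

variable (k N n) in
/-- **The space `(HW_{χ₁} ⊗ HW_{χ₂} ⊗ HW_{χ₃})^{S_n}` as functions on triples of words**: symmetric
under the diagonal position action, with all partial functions highest-weight vectors of the
prescribed weights (the tree's `tripleHw` intersected with the `S_n`-invariants). Its dimension is
the Kronecker coefficient (`finrank_symTripleHw`). [cite: IkenmeyerPanova2017, §1.1 (the semigroup property)] -/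
def symTripleHw (χ₁ χ₂ χ₃ : Weight (Fin N)) : Submodule k (Word3 N n → k) where
  carrier := {M | M ∈ tripleHw k N n χ₁ χ₂ χ₃ ∧ ∀ τ t, M (permute3 τ t) = M t}
  add_mem' {M M'} hM hM' := ⟨Submodule.add_mem _ hM.1 hM'.1, fun τ t => by
    simp only [Pi.add_apply, hM.2 τ t, hM'.2 τ t]⟩
  zero_mem' := ⟨Submodule.zero_mem _, fun _ _ => rfl⟩
  smul_mem' c {M} hM := ⟨Submodule.smul_mem _ c hM.1, fun τ t => by
    simp only [Pi.smul_apply, hM.2 τ t]⟩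

/-- Membership in `symTripleHw` (unfolding lemma). [folklore] -/
theorem mem_symTripleHw_iff (χ₁ χ₂ χ₃ : Weight (Fin N)) (M : Word3 N n → k) :
    M ∈ symTripleHw k N n χ₁ χ₂ χ₃ ↔
      M ∈ tripleHw k N n χ₁ χ₂ χ₃ ∧ ∀ τ t, M (permute3 τ t) = M t :=
  Iff.rfl

/-- `symTripleHw` is linearly equivalent to the `S_n`-invariants of the slice representation
`tripleHwRep` (same underlying functions). [folklore] -/
def symTripleHwEquivInvariants (χ₁ χ₂ χ₃ : Weight (Fin N)) :
    symTripleHw k N n χ₁ χ₂ χ₃ ≃ₗ[k] (tripleHwRep k N n χ₁ χ₂ χ₃).invariants where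
  toFun M := ⟨⟨M.1, M.2.1⟩, by
    rw [Representation.mem_invariants]
    intro τ
    apply Subtype.ext
    funext t
    rw [coe_tripleHwRep_apply]
    exact M.2.2 τ t⟩
  invFun x := ⟨((x.1 : tripleHw k N n χ₁ χ₂ χ₃) : Word3 N n → k), x.1.2, fun τ t => by
    have h := (Representation.mem_invariants _ _).1 x.2 τ
    have := congrArg (fun y : tripleHw k N n χ₁ χ₂ χ₃ => (y : Word3 N n → k) t) h
    rwa [coe_tripleHwRep_apply] at this⟩
  left_inv _ := rfl
  right_inv _ := rfl
  map_add' _ _ := rfl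
  map_smul' _ _ := rfl

/-- **`dim symTripleHw (λ, μ, ν) = g(λ, μ, ν)`** for partitions with at most `N` parts
(characteristic zero): `finrank_invariants_tripleHwRep` transported along
`symTripleHwEquivInvariants`. [cite: IkenmeyerPanova2017, §1.1 (the semigroup property)] -/
theorem finrank_symTripleHw [CharZero k] (lam mu nu : Nat.Partition n)
    (hl : lam.parts.card ≤ N) (hm : mu.parts.card ≤ N) (hn : nu.parts.card ≤ N) :
    Module.finrank k (symTripleHw k N n (Weight.ofPartition N lam) (Weight.ofPartition N mu)
        (Weight.ofPartition N nu)) = kroneckerCoeff k lam mu nu := by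
  rw [(symTripleHwEquivInvariants _ _ _).finrank_eq]
  exact finrank_invariants_tripleHwRep lam mu nu hl hm hn

/-- For `M ∈ HW_{χ₁} ⊗ HW_{χ₂} ⊗ HW_{χ₃}`, the first leg action of an upper triangular `g` is
multiplication by `χ₁(g)`. [folklore] -/
theorem legAct₁_eq_smul_of_mem_tripleHw {χ₁ χ₂ χ₃ : Weight (Fin N)} {M : Word3 N n → k}
    (hM : M ∈ tripleHw k N n χ₁ χ₂ χ₃) {g : GL (Fin N) k} (hg : IsUpperTriangular g) :
    legAct₁ g M = weightChar χ₁ g • M := by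
  funext t
  obtain ⟨h1, -, -⟩ := (mem_tripleHw_iff _ _ _ M).1 hM
  exact congrFun (h1 t.1.2 t.2 g hg) t.1.1

/-- For `M ∈ HW_{χ₁} ⊗ HW_{χ₂} ⊗ HW_{χ₃}`, the second leg action of an upper triangular `g` is
multiplication by `χ₂(g)`. [folklore] -/
theorem legAct₂_eq_smul_of_mem_tripleHw {χ₁ χ₂ χ₃ : Weight (Fin N)} {M : Word3 N n → k}
    (hM : M ∈ tripleHw k N n χ₁ χ₂ χ₃) {g : GL (Fin N) k} (hg : IsUpperTriangular g) :
    legAct₂ g M = weightChar χ₂ g • M := by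
  funext t
  obtain ⟨-, h2, -⟩ := (mem_tripleHw_iff _ _ _ M).1 hM
  exact congrFun (h2 t.1.1 t.2 g hg) t.1.2

/-- For `M ∈ HW_{χ₁} ⊗ HW_{χ₂} ⊗ HW_{χ₃}`, the third leg action of an upper triangular `g` is
multiplication by `χ₃(g)`. [folklore] -/
theorem legAct₃_eq_smul_of_mem_tripleHw {χ₁ χ₂ χ₃ : Weight (Fin N)} {M : Word3 N n → k}
    (hM : M ∈ tripleHw k N n χ₁ χ₂ χ₃) {g : GL (Fin N) k} (hg : IsUpperTriangular g) :
    legAct₃ g M = weightChar χ₃ g • M := by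
  funext t
  obtain ⟨-, -, h3⟩ := (mem_tripleHw_iff _ _ _ M).1 hM
  exact congrFun (h3 t.1.1 t.1.2 g hg) t.2

/-- **Leg-wise semi-invariance characterises `HW_{χ₁} ⊗ HW_{χ₂} ⊗ HW_{χ₃}`.** [folklore] -/
theorem mem_tripleHw_of_legAct {χ₁ χ₂ χ₃ : Weight (Fin N)} {M : Word3 N n → k}
    (h₁ : ∀ g : GL (Fin N) k, IsUpperTriangular g → legAct₁ g M = weightChar χ₁ g • M)
    (h₂ : ∀ g : GL (Fin N) k, IsUpperTriangular g → legAct₂ g M = weightChar χ₂ g • M)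
    (h₃ : ∀ g : GL (Fin N) k, IsUpperTriangular g → legAct₃ g M = weightChar χ₃ g • M) :
    M ∈ tripleHw k N n χ₁ χ₂ χ₃ := by
  rw [mem_tripleHw_iff]
  refine ⟨fun w₂ w₃ g hg => ?_, fun w₁ w₃ g hg => ?_, fun w₁ w₂ g hg => ?_⟩
  · funext w₁; exact congrFun (h₁ g hg) ((w₁, w₂), w₃)
  · funext w₂; exact congrFun (h₂ g hg) ((w₁, w₂), w₃)
  · funext w₃; exact congrFun (h₃ g hg) ((w₁, w₂), w₃)

/-- Injectivity of the dictionary on symmetric tensors, difference form. [folklore] -/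
theorem eq_of_triplePoly_eq [CharZero k] {M M' : Word3 N n → k}
    (hM : ∀ τ t, M (permute3 τ t) = M t) (hM' : ∀ τ t, M' (permute3 τ t) = M' t)
    (h : triplePoly M = triplePoly M') : M = M' := by
  have hsub : M - M' = M + (-1 : k) • M' := by
    funext t; simp [sub_eq_add_neg]
  have h0 : triplePoly (M - M') = 0 := by
    rw [hsub, triplePoly_add, triplePoly_smul, h, neg_one_smul, add_neg_cancel]
  have := eq_zero_of_triplePoly_eq_zero (fun τ t => by
    simp only [Pi.sub_apply, hM τ t, hM' τ t]) h0
  exact sub_eq_zero.1 this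

end Spaces

/-! ### §4 The determinant attached to the letter `0` of the first word -/

section Det

variable {k : Type*} [Field k] {N d : ℕ}

/-- Sums over `Fin N` of functions vanishing above `d` are sums over `Fin d`. [folklore] -/
theorem sum_eq_sum_castLE {R : Type*} [AddCommMonoid R] (hd : d ≤ N) (f : Fin N → R)
    (hf : ∀ i : Fin N, d ≤ (i : ℕ) → f i = 0) : ∑ i, f i = ∑ a : Fin d, f (Fin.castLE hd a) := by
  classical
  have hR : ∑ a : Fin d, f (Fin.castLE hd a) =
      ∑ i ∈ (Finset.univ : Finset (Fin d)).map (Fin.castLEEmb hd), f i := by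
    rw [Finset.sum_map]; rfl
  rw [hR]
  refine (Finset.sum_subset (Finset.subset_univ _) fun i _ hi => hf i ?_).symm
  by_contra hlt
  exact hi (Finset.mem_map.2 ⟨⟨i, not_le.1 hlt⟩, Finset.mem_univ _, Fin.ext rfl⟩)

/-- Products over `Fin N` of functions equal to `1` above `d` are products over `Fin d`.
[folklore] -/
theorem prod_eq_prod_castLE {R : Type*} [CommMonoid R] (hd : d ≤ N) (f : Fin N → R)
    (hf : ∀ i : Fin N, d ≤ (i : ℕ) → f i = 1) : ∏ i, f i = ∏ a : Fin d, f (Fin.castLE hd a) := by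
  classical
  have hR : ∏ a : Fin d, f (Fin.castLE hd a) =
      ∏ i ∈ (Finset.univ : Finset (Fin d)).map (Fin.castLEEmb hd), f i := by
    rw [Finset.prod_map]; rfl
  rw [hR]
  refine (Finset.prod_subset (Finset.subset_univ _) fun i _ hi => hf i ?_).symm
  by_contra hlt
  exact hi (Finset.mem_map.2 ⟨⟨i, not_le.1 hlt⟩, Finset.mem_univ _, Fin.ext rfl⟩)

variable [NeZero N]

variable (k) in
/-- The `d × d` matrix `(X_{((0, i), j)})_{i, j < d}` of variables attached to the letter `0` of the
first word. [cite: Manivel2011, §3.4 (T(γ₁))] -/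
def legDetMatrix (hd : d ≤ N) : Matrix (Fin d) (Fin d) (MvPolynomial (Alpha N) k) :=
  Matrix.of fun i j => X (((0 : Fin N), Fin.castLE hd i), Fin.castLE hd j)

variable (k) in
/-- **The determinant `D = det (X_{((0, i), j)})_{i, j < d}`**, the polynomial of the unique (up
to scalar) invariant of weight `(d ε₀, 1^d, 1^d)` (Manivel's `γ₁^n`, the determinant of `T(γ₁)`).
[cite: Manivel2011, §3.4] -/
def legDet (hd : d ≤ N) : MvPolynomial (Alpha N) k :=
  (legDetMatrix k hd).det

/-- Unfolding lemma for `legDetMatrix`. [folklore] -/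
@[simp] theorem legDetMatrix_apply (hd : d ≤ N) (i j : Fin d) :
    legDetMatrix k hd i j = X (((0 : Fin N), Fin.castLE hd i), Fin.castLE hd j) :=
  rfl

/-- `D` is the generic determinant renamed into the variables of the letter `0`. [folklore] -/
theorem legDet_eq_rename (hd : d ≤ N) :
    legDet k hd = rename (fun ij : Fin d × Fin d => ((((0 : Fin N), Fin.castLE hd ij.1), Fin.castLE hd ij.2) : Alpha N))
      (Matrix.mvPolynomialX (Fin d) (Fin d) k).det := by
  rw [legDet, AlgHom.map_det]
  congr 1
  ext i j
  simp [Matrix.mvPolynomialX_apply]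

/-- **`D ≠ 0`** (the generic determinant is nonzero and renaming along an injection is injective).
[folklore] -/
theorem legDet_ne_zero (hd : d ≤ N) : legDet k hd ≠ 0 := by
  rw [legDet_eq_rename]
  have hinj : Function.Injective
      (fun ij : Fin d × Fin d => ((((0 : Fin N), Fin.castLE hd ij.1), Fin.castLE hd ij.2) : Alpha N)) := by
    intro a b h
    simp only [Prod.mk.injEq] at h
    exact Prod.ext (Fin.castLE_injective hd h.1.2) (Fin.castLE_injective hd h.2)
  intro h
  exact Matrix.det_mvPolynomialX_ne_zero (Fin d) k
    ((rename_injective _ hinj) (by rw [h, map_zero]))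

/-- **`D` is a form of degree `d`.** [folklore] -/
theorem isHomogeneous_legDet (hd : d ≤ N) : (legDet k hd).IsHomogeneous d := by
  rw [legDet, Matrix.det_apply]
  refine IsHomogeneous.sum _ _ _ fun σ _ => ?_
  rw [Units.smul_def, zsmul_eq_mul, ← map_intCast (C : k →+* MvPolynomial (Alpha N) k)]
  refine IsHomogeneous.C_mul ?_ _
  have := IsHomogeneous.prod (Finset.univ : Finset (Fin d))
    (fun i => legDetMatrix k hd (σ i) i) (fun _ => 1) (fun i _ => isHomogeneous_X _ _)
  simpa using this

/-- The weight `d ε₀` of `D` for the first leg. [folklore] -/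
def detWeight₁ (N d : ℕ) [NeZero N] : Weight (Fin N) := Pi.single 0 (d : ℤ)

/-- The weight `(1^d, 0^{N-d})` of `D` for the second and third legs. [folklore] -/
def colWeight (N d : ℕ) : Weight (Fin N) := fun i => if (i : ℕ) < d then 1 else 0

omit [NeZero N] in
/-- The character of `colWeight` on an upper triangular matrix: the product of the first `d`
diagonal entries. [folklore] -/
theorem weightChar_colWeight (hd : d ≤ N) (g : GL (Fin N) k) :
    weightChar (colWeight N d) g = ∏ a : Fin d, (g : Matrix (Fin N) (Fin N) k) (Fin.castLE hd a) (Fin.castLE hd a) := by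
  rw [weightChar]
  rw [prod_eq_prod_castLE hd (fun i => (g : Matrix (Fin N) (Fin N) k) i i ^ (colWeight N d i))]
  · refine Finset.prod_congr rfl fun a _ => ?_
    simp [colWeight]
  · intro i hi
    simp [colWeight, not_lt.2 hi]

/-- **First-leg semi-invariance of `D`**: `g ·₁ D = g₀₀^d · D` for upper triangular `g` (only the
letter `0` feeds `X_{((0,i),j)}`). [cite: Manivel2011, §3.4] -/
theorem legSubst₁_legDet (hd : d ≤ N) {g : GL (Fin N) k} (hg : IsUpperTriangular g) :
    legSubst₁ N (g : Matrix (Fin N) (Fin N) k) (legDet k hd) = weightChar (detWeight₁ N d) g • legDet k hd := by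
  set G : Matrix (Fin N) (Fin N) k := (g : Matrix (Fin N) (Fin N) k) with hG
  have hX : ∀ i j : Fin d, legSubst₁ N G (legDetMatrix k hd i j) = C (G 0 0) * legDetMatrix k hd i j := by
    intro i j
    rw [legDetMatrix_apply, legSubst₁_X, Finset.sum_eq_single (0 : Fin N)]
    · rw [smul_eq_C_mul]
    · intro l _ hl
      rw [hG, hg.apply_eq_zero (Fin.pos_iff_ne_zero.2 hl), zero_smul]
    · intro h; exact absurd (Finset.mem_univ _) h
  have hmap : (legSubst₁ N G).mapMatrix (legDetMatrix k hd) =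
      (C (G 0 0) : MvPolynomial (Alpha N) k) • legDetMatrix k hd := by
    ext i j
    rw [AlgHom.mapMatrix_apply, Matrix.map_apply, hX, Matrix.smul_apply, smul_eq_mul]
  rw [legDet, AlgHom.map_det, hmap, Matrix.det_smul, Fintype.card_fin, detWeight₁, weightChar_single,
    smul_eq_C_mul, ← hG, zpow_natCast, map_pow]

/-- **Second-leg semi-invariance of `D`**: `g ·₂ D = (∏_{a<d} g_{aa}) · D` for upper triangular `g`
(the substituted matrix is `Bᵀ X` with `B` the upper triangular top-left `d × d` block of `g`).
[cite: Manivel2011, §3.4] -/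
theorem legSubst₂_legDet (hd : d ≤ N) {g : GL (Fin N) k} (hg : IsUpperTriangular g) :
    legSubst₂ N (g : Matrix (Fin N) (Fin N) k) (legDet k hd) = weightChar (colWeight N d) g • legDet k hd := by
  set G : Matrix (Fin N) (Fin N) k := (g : Matrix (Fin N) (Fin N) k) with hG
  -- the top-left block
  let B : Matrix (Fin d) (Fin d) k := Matrix.of fun a i => G (Fin.castLE hd a) (Fin.castLE hd i)
  have hB : B.BlockTriangular id := by
    intro a a' h
    change G (Fin.castLE hd a) (Fin.castLE hd a') = 0
    apply hg.apply_eq_zero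
    rw [Fin.lt_def, Fin.val_castLE, Fin.val_castLE]
    exact h
  have hX : ∀ i j : Fin d, legSubst₂ N G (legDetMatrix k hd i j) =
      ∑ a : Fin d, C (B a i) * legDetMatrix k hd a j := by
    intro i j
    rw [legDetMatrix_apply, legSubst₂_X]
    rw [sum_eq_sum_castLE hd]
    · refine Finset.sum_congr rfl fun a _ => ?_
      rw [smul_eq_C_mul]; rfl
    · intro i' hi'
      have hlt : Fin.castLE hd i < i' := by
        rw [Fin.lt_def]; exact lt_of_lt_of_le (by simp) hi'
      simp only
      rw [hG, hg.apply_eq_zero hlt, zero_smul]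
  have hmap : (legSubst₂ N G).mapMatrix (legDetMatrix k hd) = (B.map C).transpose * legDetMatrix k hd := by
    ext i j
    rw [AlgHom.mapMatrix_apply, Matrix.map_apply, hX, Matrix.mul_apply]
    rfl
  rw [legDet, AlgHom.map_det, hmap, Matrix.det_mul, Matrix.det_transpose,
    ← RingHom.mapMatrix_apply, ← RingHom.map_det, Matrix.det_of_upperTriangular hB,
    weightChar_colWeight hd, smul_eq_C_mul]
  rfl

/-- **Third-leg semi-invariance of `D`**: `g ·₃ D = (∏_{a<d} g_{aa}) · D` for upper triangular `g`
(the substituted matrix is `X B`). [cite: Manivel2011, §3.4] -/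
theorem legSubst₃_legDet (hd : d ≤ N) {g : GL (Fin N) k} (hg : IsUpperTriangular g) :
    legSubst₃ N (g : Matrix (Fin N) (Fin N) k) (legDet k hd) = weightChar (colWeight N d) g • legDet k hd := by
  set G : Matrix (Fin N) (Fin N) k := (g : Matrix (Fin N) (Fin N) k) with hG
  let B : Matrix (Fin d) (Fin d) k := Matrix.of fun a i => G (Fin.castLE hd a) (Fin.castLE hd i)
  have hB : B.BlockTriangular id := by
    intro a a' h
    change G (Fin.castLE hd a) (Fin.castLE hd a') = 0
    apply hg.apply_eq_zero
    rw [Fin.lt_def, Fin.val_castLE, Fin.val_castLE]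
    exact h
  have hX : ∀ i j : Fin d, legSubst₃ N G (legDetMatrix k hd i j) =
      ∑ c : Fin d, legDetMatrix k hd i c * C (B c j) := by
    intro i j
    rw [legDetMatrix_apply, legSubst₃_X]
    rw [sum_eq_sum_castLE hd]
    · refine Finset.sum_congr rfl fun c _ => ?_
      rw [smul_eq_C_mul, mul_comm]; rfl
    · intro j' hj'
      have hlt : Fin.castLE hd j < j' := by
        rw [Fin.lt_def]; exact lt_of_lt_of_le (by simp) hj'
      simp only
      rw [hG, hg.apply_eq_zero hlt, zero_smul]
  have hmap : (legSubst₃ N G).mapMatrix (legDetMatrix k hd) = legDetMatrix k hd * B.map C := by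
    ext i j
    rw [AlgHom.mapMatrix_apply, Matrix.map_apply, hX, Matrix.mul_apply]
    rfl
  rw [legDet, AlgHom.map_det, hmap, Matrix.det_mul, ← RingHom.mapMatrix_apply, ← RingHom.map_det,
    Matrix.det_of_upperTriangular hB, weightChar_colWeight hd, smul_eq_C_mul, mul_comm]
  rfl

end Det

/-! ### §5 Division by the determinant -/

section Division

variable {k : Type*} [Field k] {N : ℕ}

/-- **Cancellation**: if an algebra endomorphism `φ` scales `D · Q` by `c` and `D ≠ 0` by
`c₀ ≠ 0`, then it scales `Q` by `c / c₀` (`k[X]` is a domain). [folklore] -/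
theorem map_quot_eq_smul {σ : Type*} {φ : MvPolynomial σ k →ₐ[k] MvPolynomial σ k}
    {D Q : MvPolynomial σ k} {c c₀ : k} (hD : D ≠ 0) (hDQ : φ (D * Q) = c • (D * Q))
    (hD' : φ D = c₀ • D) (hc₀ : c₀ ≠ 0) : φ Q = (c / c₀) • Q := by
  have h1 : D * (c₀ • φ Q) = D * (c • Q) := by
    rw [mul_smul_comm, ← smul_mul_assoc, ← hD', ← map_mul, hDQ, mul_smul_comm]
  have h2 := mul_left_cancel₀ hD h1
  have h3 : φ Q = c₀⁻¹ • (c • Q) := by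
    rw [← h2, smul_smul, inv_mul_cancel₀ hc₀, one_smul]
  rw [h3, smul_smul, div_eq_inv_mul]

/-- **A factor of a form by a nonzero form is a form**: if `D ≠ 0` is homogeneous of degree `d` and
`D · Q` is homogeneous of degree `d + a`, then `Q` is homogeneous of degree `a` (compare homogeneous
components; `k[X]` is a domain). [folklore] -/
theorem isHomogeneous_of_mul_left {σ : Type*} {D Q : MvPolynomial σ k} {d a m : ℕ}
    (hD : D.IsHomogeneous d) (hD0 : D ≠ 0) (hDQ : (D * Q).IsHomogeneous m) (hm : m = a + d) :
    Q.IsHomogeneous a := by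
  classical
  -- every homogeneous component of `Q` in degree `j ≠ a` vanishes
  have hcomp : ∀ j, j ≠ a → homogeneousComponent j Q = 0 := by
    intro j hj
    have hsum : D * Q = ∑ i ∈ Finset.range (Q.totalDegree + 1), D * homogeneousComponent i Q := by
      conv_lhs => rw [← sum_homogeneousComponent Q]
      rw [Finset.mul_sum]
    have h1 : homogeneousComponent (d + j) (D * Q) = D * homogeneousComponent j Q := by
      rw [hsum, map_sum]
      have hterm : ∀ i ∈ Finset.range (Q.totalDegree + 1),
          homogeneousComponent (d + j) (D * homogeneousComponent i Q) =
            if i = j then D * homogeneousComponent j Q else 0 := by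
        intro i _
        rw [homogeneousComponent_of_mem (hD.mul (homogeneousComponent_isHomogeneous i Q))]
        by_cases hij : i = j
        · subst hij; simp
        · rw [if_neg (by omega), if_neg hij]
      rw [Finset.sum_congr rfl hterm, Finset.sum_ite_eq']
      split_ifs with hmem
      · rfl
      · rw [Finset.mem_range, not_lt] at hmem
        rw [homogeneousComponent_eq_zero _ _ (by omega), mul_zero]
    have h2 : homogeneousComponent (d + j) (D * Q) = 0 := by
      rw [homogeneousComponent_of_mem hDQ, if_neg (by omega)]
    rw [h2] at h1
    exact (mul_eq_zero.1 h1.symm).resolve_left hD0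
  have hQ : Q = homogeneousComponent a Q := by
    conv_lhs => rw [← sum_homogeneousComponent Q]
    rw [Finset.sum_eq_single a (fun j _ hj => hcomp j hj)]
    intro ha
    rw [Finset.mem_range, not_lt] at ha
    rw [homogeneousComponent_eq_zero _ _ (by omega)]
  rw [hQ]
  exact homogeneousComponent_isHomogeneous a Q

/-- Characters of differences of weights are quotients. [folklore] -/
theorem weightChar_sub {σ : Type*} [Fintype σ] [LinearOrder σ] (χ ψ : Weight σ) {g : GL σ k}
    (hg : IsUpperTriangular g) : weightChar (χ - ψ) g = weightChar χ g / weightChar ψ g := by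
  rw [eq_div_iff (weightChar_ne_zero ψ hg), ← weightChar_add _ _ hg, sub_add_cancel]

variable [NeZero N] {a d : ℕ}

/-- The quotient by `D` (or `0` if `D` does not divide). [folklore] -/
def quotDet (hd : d ≤ N) (P : MvPolynomial (Alpha N) k) : MvPolynomial (Alpha N) k := by
  classical
  exact if h : legDet k hd ∣ P then Classical.choose h else 0

/-- `D · (P / D) = P` when `D ∣ P`. [folklore] -/
theorem legDet_mul_quotDet (hd : d ≤ N) {P : MvPolynomial (Alpha N) k} (h : legDet k hd ∣ P) :
    legDet k hd * quotDet hd P = P := by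
  classical
  rw [quotDet, dif_pos h]
  exact (Classical.choose_spec h).symm

/-- Uniqueness of the quotient (`k[X]` is a domain). [folklore] -/
theorem quotDet_eq (hd : d ≤ N) {P Q : MvPolynomial (Alpha N) k} (h : legDet k hd * Q = P) :
    quotDet hd P = Q := by
  have hdvd : legDet k hd ∣ P := ⟨Q, h.symm⟩
  exact mul_left_cancel₀ (legDet_ne_zero hd) ((legDet_mul_quotDet hd hdvd).trans h.symm)

variable [CharZero k]

/-- **Division by `D` lowers the weight by `(d ε₀, 1^d, 1^d)`.** If `M` is a symmetric triple tensor
of length `a + d` with highest-weight partial functions of weights `χ₁, χ₂, χ₃`, and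
`P_M = D · Q`, then the array of `Q` is a symmetric triple tensor of length `a` with highest-weight
partial functions of weights `χ₁ - d ε₀, χ₂ - 1^d, χ₃ - 1^d`, and `P_{A(Q)} = Q`: the quotient is a
form of degree `a` (`isHomogeneous_of_mul_left`) and inherits the three semi-invariances by
cancellation (`map_quot_eq_smul`), which transfer back through the dictionary.
[cite: Manivel2011, §3.4] -/
theorem tripleArr_quot_mem (hd : d ≤ N) {χ₁ χ₂ χ₃ : Weight (Fin N)} {M : Word3 N (a + d) → k}
    (hM : M ∈ symTripleHw k N (a + d) χ₁ χ₂ χ₃) {Q : MvPolynomial (Alpha N) k}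
    (hQ : triplePoly M = legDet k hd * Q) :
    tripleArr a Q ∈ symTripleHw k N a (χ₁ - detWeight₁ N d) (χ₂ - colWeight N d) (χ₃ - colWeight N d) ∧
      triplePoly (tripleArr a Q) = Q := by
  have hD0 := legDet_ne_zero (k := k) hd
  -- `Q` is a form of degree `a`
  have hQh : Q.IsHomogeneous a :=
    isHomogeneous_of_mul_left (isHomogeneous_legDet hd) hD0 (hQ ▸ isHomogeneous_triplePoly M) rfl
  have hPQ : triplePoly (tripleArr a Q) = Q := triplePoly_tripleArr hQh
  have hsym : ∀ τ t, tripleArr a Q (permute3 τ t) = tripleArr a Q t := tripleArr_permute3 Q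
  refine ⟨⟨mem_tripleHw_of_legAct ?_ ?_ ?_, hsym⟩, hPQ⟩
  · intro g hg
    refine eq_of_triplePoly_eq (legAct₁_permute3 g hsym) (fun τ t => by
      simp only [Pi.smul_apply, hsym τ t]) ?_
    rw [triplePoly_legAct₁, hPQ, triplePoly_smul, hPQ, weightChar_sub _ _ hg]
    refine map_quot_eq_smul hD0 ?_ (legSubst₁_legDet hd hg) (weightChar_ne_zero _ hg)
    rw [← hQ, ← triplePoly_legAct₁, legAct₁_eq_smul_of_mem_tripleHw hM.1 hg, triplePoly_smul]
  · intro g hg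
    refine eq_of_triplePoly_eq (legAct₂_permute3 g hsym) (fun τ t => by
      simp only [Pi.smul_apply, hsym τ t]) ?_
    rw [triplePoly_legAct₂, hPQ, triplePoly_smul, hPQ, weightChar_sub _ _ hg]
    refine map_quot_eq_smul hD0 ?_ (legSubst₂_legDet hd hg) (weightChar_ne_zero _ hg)
    rw [← hQ, ← triplePoly_legAct₂, legAct₂_eq_smul_of_mem_tripleHw hM.1 hg, triplePoly_smul]
  · intro g hg
    refine eq_of_triplePoly_eq (legAct₃_permute3 g hsym) (fun τ t => by
      simp only [Pi.smul_apply, hsym τ t]) ?_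
    rw [triplePoly_legAct₃, hPQ, triplePoly_smul, hPQ, weightChar_sub _ _ hg]
    refine map_quot_eq_smul hD0 ?_ (legSubst₃_legDet hd hg) (weightChar_ne_zero _ hg)
    rw [← hQ, ← triplePoly_legAct₃, legAct₃_eq_smul_of_mem_tripleHw hM.1 hg, triplePoly_smul]

/-- **Rank inequality by division.** If every `P_M`, `M` a symmetric triple tensor of length
`a + d` with highest-weight partial functions of weights `(χ₁, χ₂, χ₃)`, is divisible by `D`,
then `M ↦ A(P_M / D)` is an injective linear map into the corresponding space of length `a` and
weights `(χ₁ - d ε₀, χ₂ - 1^d, χ₃ - 1^d)`; in particular the dimension does not exceed the latter's.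
[cite: Manivel2011, §3.4] -/
theorem finrank_symTripleHw_le_of_forall_dvd (hd : d ≤ N) (χ₁ χ₂ χ₃ : Weight (Fin N))
    (hdiv : ∀ M ∈ symTripleHw k N (a + d) χ₁ χ₂ χ₃, legDet k hd ∣ triplePoly M) :
    Module.finrank k (symTripleHw k N (a + d) χ₁ χ₂ χ₃) ≤
      Module.finrank k (symTripleHw k N a (χ₁ - detWeight₁ N d) (χ₂ - colWeight N d)
        (χ₃ - colWeight N d)) := by
  -- the division map
  have hmul : ∀ M : symTripleHw k N (a + d) χ₁ χ₂ χ₃,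
      triplePoly (M : Word3 N (a + d) → k) = legDet k hd * quotDet hd (triplePoly (M : Word3 N (a + d) → k)) :=
    fun M => (legDet_mul_quotDet hd (hdiv M M.2)).symm
  let f : symTripleHw k N (a + d) χ₁ χ₂ χ₃ →ₗ[k]
      symTripleHw k N a (χ₁ - detWeight₁ N d) (χ₂ - colWeight N d) (χ₃ - colWeight N d) :=
    { toFun := fun M => ⟨tripleArr a (quotDet hd (triplePoly (M : Word3 N (a + d) → k))),
        (tripleArr_quot_mem hd M.2 (hmul M)).1⟩
      map_add' := fun M M' => by
        apply Subtype.ext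
        change tripleArr a (quotDet hd (triplePoly ((M : Word3 N (a + d) → k) + (M' : Word3 N (a + d) → k)))) =
          tripleArr a (quotDet hd (triplePoly (M : Word3 N (a + d) → k))) +
            tripleArr a (quotDet hd (triplePoly (M' : Word3 N (a + d) → k)))
        rw [← tripleArr_add, quotDet_eq hd]
        rw [mul_add, ← hmul M, ← hmul M', triplePoly_add]
      map_smul' := fun c M => by
        apply Subtype.ext
        change tripleArr a (quotDet hd (triplePoly (c • (M : Word3 N (a + d) → k)))) =
          c • tripleArr a (quotDet hd (triplePoly (M : Word3 N (a + d) → k)))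
        rw [← tripleArr_smul, quotDet_eq hd]
        rw [mul_smul_comm, ← hmul M, triplePoly_smul] }
  have hf : Function.Injective f := by
    rw [← LinearMap.ker_eq_bot, LinearMap.ker_eq_bot']
    intro M hM0
    have h1 : tripleArr a (quotDet hd (triplePoly (M : Word3 N (a + d) → k))) = 0 :=
      congrArg Subtype.val hM0
    have h2 : quotDet hd (triplePoly (M : Word3 N (a + d) → k)) = 0 := by
      rw [← (tripleArr_quot_mem hd M.2 (hmul M)).2, h1, triplePoly_zero]
    have h3 : triplePoly (M : Word3 N (a + d) → k) = 0 := by rw [hmul M, h2, mul_zero]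
    exact Subtype.ext (eq_zero_of_triplePoly_eq_zero M.2.2 h3)
  exact LinearMap.finrank_le_finrank_of_injective hf

end Division

end Literature.NumberTheory.DiophantineGeometry
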